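import Mathlib
import HarnessLib
import Summits.NavierStokesRegularity.NavierStokesRegularity.Theorems.TaylorModelRungThreeReadoutVGrowth
import Summits.NavierStokesRegularity.NavierStokesRegularity.Theorems.TaylorModelRungThreeCertificateFormatVInterpLemmas

/-!
# Crux K1b-DR (stmt-NavierStokesRegularity-23954), line `taylor-model` — (R2) tube growth: the BRIDGE from interval matrix
# products (`mulII`, `MemMat`, `magM`-row sums) to the semantic growth factors of `…ReadoutVGrowth`

`…ReadoutVGrowth` reduced clause (R2) of `ReadoutsV` to two facts per certified pair: the real product kernel
`kerOf (kiter Ac a n)` of an admissible chain lies in an interval kernel `[Plo, Phi]`, and a row-sum inequality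
`max|Plo||Phi| · ω ≤ G · ω` (or its split-vector variant).  This file states both in the COORDINATE vocabulary of the checker
(`T : CertTables K` with the record's window, `matOfKer`, `MemMat`, `mulII`, `IntervalD.mag`):

* `matOfKer_kerOf_kiter_succ` — the coordinate matrix of the product kernel obeys the matrix-product recursion;
* `memMat_kiter_one`, `memMat_kiter_succ` — hence an admissible chain's product matrix lies in the checker's interval product
  `mulII M_{a+n} (⋯ (mulII M_{a+1} M_a))`, factor by factor (`memMat_mulII`);
* `kerMem_of_memMat_kiter` — back to `KerMem … (kerLo P) (kerHi P)`;
* `rowsum_window_le_of_coord` — a coordinate row-sum bound `Σ_t mag(P_{r,t})·w_t ≤ b_r` IS the window-enumeration hypothesis of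
  `inBall_kiter_of_prodMem` / `inBall_kiter_split`;
* `inBall_kiter_of_memMat` (PROPAGATE-V-SPEC §10 (i), within-block pair) and `inBall_kiter_split_of_memMat` (§10 (ii), one split):
  the (R2) instance for a pair from `MemMat` facts and real row-sum inequalities — what remains for a checker is dyadic
  upward rounding of those sums (`dotUp`/`absMulVecUp` pattern) and the enclosures of `ω_j`.

MODEL-lattice rung TL-M3 only; nothing here is a statement about the Navier–Stokes equations, and nothing about the
certificate is asserted.
-/

noncomputable section

-- the sub-problem namespace repeats the summit name by design (D-0017)
set_option linter.dupNamespace false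

namespace Summit.NavierStokesRegularity.NavierStokesRegularity.Theorems.TaylorModelCert

open scoped BigOperators
open Literature.Analysis.FluidPDE.TaoCascade Literature.Analysis.FluidPDE.TaoCascade.TaylorChain
open Summit.NavierStokesRegularity.NavierStokesRegularity.Theorems.TaylorModelReadout
open Summit.NavierStokesRegularity.NavierStokesRegularity.Theorems.TaylorModelV

namespace CertTables

variable {K : Type} (T : CertTables K) {cd : CertData} (hKb : cd.Kb = T.Kb) (hKa : cd.Ka = T.Ka)
include hKb hKa

/-! ### The product kernel in coordinates -/

omit hKb hKa in
/-- `max |lo| |hi|` of an interval-matrix entry is its `mag`. [folklore] -/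
theorem max_abs_kerLo_kerHi (P : Array (Array IntervalD)) (i' : Fin 4) (k' : ℤ) (i : Fin 4) (k : ℤ) :
    max |T.kerLo P i' k' i k| |T.kerHi P i' k' i k| = (IntervalD.mag (imget P (T.idx i' k') (T.idx i k))).toReal := by
  simp only [kerLo, kerHi, IntervalD.mag, Dyad.toReal_max, Dyad.toReal_abs]

/-- **Matrix-product recursion of the product kernel** (coordinates `r, c < n`):
`mat (kerOf (kiter A s₀ (n+1))) r c = Σ_{t<n} mat (A (s₀+n)) r t · mat (kerOf (kiter A s₀ n)) t c`. [folklore] -/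
theorem matOfKer_kerOf_kiter_succ (A : ℕ → Ker) (s₀ n : ℕ) {r : ℕ} (hr : r < T.n) (c : ℕ) :
    T.matOfKer (kerOf (kiter cd A s₀ (n + 1))) r c =
      ∑ t ∈ Finset.range T.n, T.matOfKer (A (s₀ + n)) r t * T.matOfKer (kerOf (kiter cd A s₀ n)) t c := by
  have hkr := T.InW_wk hr
  simp only [matOfKer]
  rw [kerOf_kiter_succ A s₀ n (T.wi r) (by rw [hKb]; exact hkr.1) (by rw [hKa]; exact hkr.2)]
  exact T.sum_nW_eq_sum_range cd hKb hKa
    (fun i k => A (s₀ + n) (T.wi r) (T.wk r) i k * kerOf (kiter cd A s₀ n) i k (T.wi c) (T.wk c))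

/-- **One factor**: the product kernel of a one-step chain has the coordinate matrix of its kernel, so it lies in the same
interval matrix. [folklore] -/
theorem memMat_kiter_one {A : ℕ → Ker} {s₀ : ℕ} {M : Array (Array IntervalD)} (hM : MemMat T.n (T.matOfKer (A s₀)) M) :
    MemMat T.n (T.matOfKer (kerOf (kiter cd A s₀ 1))) M := by
  intro r hr c hc
  have hkr := T.InW_wk hr
  have hkc := T.InW_wk hc
  have e : T.matOfKer (kerOf (kiter cd A s₀ 1)) r c = T.matOfKer (A s₀) r c := by
    simp only [matOfKer, kerOf]
    show kapp cd (A (s₀ + 0)) (basisSt (T.wi c) (T.wk c)) (T.wi r) (T.wk r) = _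
    rw [Nat.add_zero, kapp_apply_of_InW _ _ (T.wi r) (by rw [hKb, hKa]; exact hkr)]
    simp only [toVec]
    rw [T.sum_nW_eq_sum_range cd hKb hKa (fun i k => A s₀ (T.wi r) (T.wk r) i k * basisSt (T.wi c) (T.wk c) i k)]
    rw [Finset.sum_eq_single c]
    · have : basisSt (T.wi c) (T.wk c) (T.wi c) (T.wk c) = 1 := by simp [basisSt]
      rw [this, mul_one]
    · intro t ht htc
      have hkt := T.InW_wk (Finset.mem_range.1 ht)
      have : basisSt (T.wi c) (T.wk c) (T.wi t) (T.wk t) = 0 := by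
        simp only [basisSt]
        rw [if_neg]
        rintro ⟨h1, h2⟩
        exact htc (by rw [← T.idx_wi_wk (Finset.mem_range.1 ht), h1, h2, T.idx_wi_wk hc])
      rw [this, mul_zero]
    · intro h; exact absurd (Finset.mem_range.2 hc) h
  rw [e]; exact hM r hr c hc

/-- **One more factor**: if the product matrix of the chain over `[s₀, s₀+n)` lies in `P` and the next kernel's matrix lies in
`M`, the product matrix over `[s₀, s₀+n+1)` lies in `mulII M P`. [folklore] -/
theorem memMat_kiter_succ (prec : ℕ) {A : ℕ → Ker} {s₀ n : ℕ} {P M : Array (Array IntervalD)}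
    (hP : MemMat T.n (T.matOfKer (kerOf (kiter cd A s₀ n))) P) (hM : MemMat T.n (T.matOfKer (A (s₀ + n))) M) :
    MemMat T.n (T.matOfKer (kerOf (kiter cd A s₀ (n + 1)))) (mulII T.n prec M P) := by
  intro r hr c hc
  rw [T.matOfKer_kerOf_kiter_succ hKb hKa A s₀ n hr c]
  exact memMat_mulII prec hM hP r hr c hc

/-- The kernels of an admissible chain have coordinate matrices in the checker's kernel boxes. [folklore] -/
theorem memMat_of_kerMem {A : Ker} {M : Array (Array IntervalD)} (hA : KerMem cd A (T.kerLo M) (T.kerHi M)) :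
    MemMat T.n (T.matOfKer A) M :=
  T.memMat_matOfKer hKb hKa hA

/-- Back to kernels: a product matrix in `P` gives the product kernel in `[kerLo P, kerHi P]`. [folklore] -/
theorem kerMem_of_memMat_kiter {A : ℕ → Ker} {s₀ n : ℕ} {P : Array (Array IntervalD)}
    (hP : MemMat T.n (T.matOfKer (kerOf (kiter cd A s₀ n))) P) :
    KerMem cd (kerOf (kiter cd A s₀ n)) (T.kerLo P) (T.kerHi P) := by
  intro i' k' hk1' hk2' i k hk1 hk2
  have hk' : -T.Kb ≤ k' ∧ k' ≤ T.Ka := by rw [← hKb, ← hKa]; exact ⟨hk1', hk2'⟩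
  have hk : -T.Kb ≤ k ∧ k ≤ T.Ka := by rw [← hKb, ← hKa]; exact ⟨hk1, hk2⟩
  have h := T.kerMem_kerOfMat hKb hKa hP i' k' hk1' hk2' i k hk1 hk2
  rwa [T.kerOfMat_matOfKer _ i' hk' i hk] at h

/-! ### Row sums: coordinates versus the window enumeration -/

/-- **A coordinate row-sum bound is the window-enumeration bound.** For weights `w, b : ℕ → ℝ` on coordinates:
`(∀ r<n, Σ_{t<n} mag(P_{r,t})·w_t ≤ b_r)` gives, for every window row `(i',k')`,
`Σ_c max|kerLo P||kerHi P|_{(i',k'),c} · w (idx c) ≤ b (idx (i',k'))`. [folklore] -/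
theorem rowsum_window_le_of_coord (P : Array (Array IntervalD)) (w b : ℕ → ℝ)
    (h : ∀ r < T.n, ∑ t ∈ Finset.range T.n, (IntervalD.mag (imget P r t)).toReal * w t ≤ b r)
    (i' : Fin 4) {k' : ℤ} (hk1' : -cd.Kb ≤ k') (hk2' : k' ≤ cd.Ka) :
    ∑ c : Fin (nW cd), max |T.kerLo P i' k' (modeOf cd c) (shellOf cd c)| |T.kerHi P i' k' (modeOf cd c) (shellOf cd c)| *
        w (T.idx (modeOf cd c) (shellOf cd c)) ≤ b (T.idx i' k') := by
  have hk' : -T.Kb ≤ k' ∧ k' ≤ T.Ka := by rw [← hKb, ← hKa]; exact ⟨hk1', hk2'⟩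
  rw [T.sum_nW_eq_sum_range cd hKb hKa
    (fun i k => max |T.kerLo P i' k' i k| |T.kerHi P i' k' i k| * w (T.idx i k))]
  refine le_trans (le_of_eq (Finset.sum_congr rfl fun t ht => ?_)) (h _ (T.idx_lt_n i' hk'))
  rw [T.max_abs_kerLo_kerHi, T.idx_wi_wk (Finset.mem_range.1 ht)]

/-! ### (R2) instances from `MemMat` facts -/

/-- **§10 (i) WITHIN-BLOCK PAIR from the interval product.** If the product matrix of every admissible chain over
`[a, a+n)` lies in `P` (by `memMat_kiter_one/succ`), and `Σ_t mag(P_{r,t})·ω_j(wk t) ≤ G·ω_j(wk r)` for all rows, then every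
admissible chain maps the `r·ω_j`-ball into the `G·r·ω_j`-ball. [folklore] -/
theorem inBall_kiter_of_memMat {j : ℕ} {A : ℕ → Ker} {a n : ℕ} {P : Array (Array IntervalD)}
    (hP : MemMat T.n (T.matOfKer (kerOf (kiter cd A a n))) P) {G : ℝ}
    (hG : ∀ r < T.n, ∑ t ∈ Finset.range T.n, (IntervalD.mag (imget P r t)).toReal * cd.ω j (T.wk t) ≤ G * cd.ω j (T.wk r))
    {v : Fin 4 → ℤ → ℝ} {r : ℝ} (hr : 0 ≤ r) (hv : cd.InBall j v r) :
    cd.InBall j (kiter cd A a n v) (G * r) := by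
  refine inBall_kiter_of_prodMem (T.kerMem_of_memMat_kiter hKb hKa hP) (fun i' k' hk1' hk2' => ?_) hr hv
  have h := T.rowsum_window_le_of_coord hKb hKa P (fun t => cd.ω j (T.wk t)) (fun r => G * cd.ω j (T.wk r)) hG i' hk1' hk2'
  have hk' : -T.Kb ≤ k' ∧ k' ≤ T.Ka := by rw [← hKb, ← hKa]; exact ⟨hk1', hk2'⟩
  simp only [T.wk_idx i' hk'] at h
  refine le_trans (le_of_eq (Finset.sum_congr rfl fun c _ => ?_)) h
  rw [T.wk_idx _ (by rw [← hKb, ← hKa]; exact shellOf_mem cd c)]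

/-- **§10 (ii) ONE SPLIT from two interval products.** `a ≤ B ≤ b`; the product matrix of every admissible chain over `[a, B)`
lies in `Q`, that over `[B, b)` in `P`; a coordinate vector `u` with `Σ_t mag(Q_{r,t})·ω_j(wk t) ≤ u_r` and
`Σ_t mag(P_{r,t})·u_t ≤ G·ω_j(wk r)`: then every admissible chain over `[a, b)` maps the `r·ω_j`-ball into the `G·r·ω_j`-ball.
[folklore] -/
theorem inBall_kiter_split_of_memMat {j : ℕ} {A : ℕ → Ker} {a B b : ℕ} (haB : a ≤ B) (hBb : B ≤ b)
    {Q P : Array (Array IntervalD)} (hQ : MemMat T.n (T.matOfKer (kerOf (kiter cd A a (B - a)))) Q)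
    (hP : MemMat T.n (T.matOfKer (kerOf (kiter cd A B (b - B)))) P) (u : ℕ → ℝ)
    (hu : ∀ r < T.n, ∑ t ∈ Finset.range T.n, (IntervalD.mag (imget Q r t)).toReal * cd.ω j (T.wk t) ≤ u r) {G : ℝ}
    (hG : ∀ r < T.n, ∑ t ∈ Finset.range T.n, (IntervalD.mag (imget P r t)).toReal * u t ≤ G * cd.ω j (T.wk r))
    {v : Fin 4 → ℤ → ℝ} {r : ℝ} (hr : 0 ≤ r) (hv : cd.InBall j v r) :
    cd.InBall j (kiter cd A a (b - a) v) (G * r) := by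
  refine inBall_kiter_split haB hBb (T.kerMem_of_memMat_kiter hKb hKa hQ) (T.kerMem_of_memMat_kiter hKb hKa hP)
    (fun i k => u (T.idx i k)) (fun i' k' hk1' hk2' => ?_) (fun i' k' hk1' hk2' => ?_) hr hv
  · have h := T.rowsum_window_le_of_coord hKb hKa Q (fun t => cd.ω j (T.wk t)) u hu i' hk1' hk2'
    refine le_trans (le_of_eq (Finset.sum_congr rfl fun c _ => ?_)) h
    rw [T.wk_idx _ (by rw [← hKb, ← hKa]; exact shellOf_mem cd c)]
  · have h := T.rowsum_window_le_of_coord hKb hKa P u (fun r => G * cd.ω j (T.wk r)) hG i' hk1' hk2'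
    have hk' : -T.Kb ≤ k' ∧ k' ≤ T.Ka := by rw [← hKb, ← hKa]; exact ⟨hk1', hk2'⟩
    simp only [T.wk_idx i' hk'] at h
    exact h

end CertTables

end Summit.NavierStokesRegularity.NavierStokesRegularity.Theorems.TaylorModelCert

end
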